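import Summits.QuantumFields.BalabanUV.Beta.EriceFlowEnclosureB12AsPrintedPointwiseFadingZeroHistory
import Summits.QuantumFields.BalabanUV.Beta.EriceFlowEnclosureB12AsPrintedPointwiseFadingLimitEnd
import Summits.QuantumFields.BalabanUV.Beta.EriceFlowEnclosureB12AsPrintedPointwiseFadingLimitOneLoop
import Summits.QuantumFields.BalabanUV.Beta.EriceFlowEnclosureB12AsPrintedPointwiseFadingLimitZeroJunction

/-!
# Beta / EriceFlowEnclosureB12AsPrintedPointwiseFadingZeroHistoryEnd — part 13d: THE ENDs.  (§1) THE PRINTED SPLIT IS CANONICAL: for ANY `T : B12Beta.OneLoopSplit β` whose remainder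
# obeys the last-coupling corner bound (AF-1) `|β¹_{k+1}(p)| ≤ C_r·p_k` on some box, the one-loop coefficients ARE part 13's zero-history values — **`T.β0 k = b⁰_k` for every k**
# (`beta0_eq_zeroHist`) — so part 11f's conclusions about β⁰ and part 13's about b⁰ concern the same numbers, and the printed remainder β¹ inherits the FADING corner bound
# `|β¹_{k+1}(v)| ≤ CΣθ^{k−i}v_i` from node U2's letters (`beta1_fading_corner`); and (§1″) THE SPLIT EXISTS LITERALLY: the moduli alone give a family `β′ = β` on every box carrying a
# `T : OneLoopSplit β′` with `T.β0 = b⁰` and the fading (AF-1) for `T.β1` (`exists_oneLoopSplit_of_moduli`).  (§2) ON THE AS-PRINTED CARRIER: `Theorem2Statement S hL` AS TYPED + prover 1's `hrg` + node U2's letters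
# ⟹ the zero-history values of `S.β` exist, obey the intrinsic (AF-0r) `|b⁰_{k+1} − b⁰_k| ≤ cθ^k`, converge at NE4's rate to THE asymptotic constant `b⋆ > 0`, and are EVENTUALLY
# BOUNDED BELOW BY `b⋆∕2 > 0` (**`zeroHist_of_typedTheorem2`**): the typed (0.31) forces eventual one-loop asymptotic freedom of the INTRINSIC coefficients — no split is assumed.
# (β-flow team, prover 2 = lower ∕ positivity side, unit `b2b-balaban-beta-bflow-p2`, gen 51; ROW AP-I × node U2's letters; END part of part 13)

HONEST FRAMING (page 1 of everything the β sub-cell writes): discharging `BetaPertH` makes Bałaban's UV stability UNCONDITIONAL — a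
real constructive-QFT result; it is NOT the continuum limit and NOT the Clay problem.  HONEST DEPENDENCY (cell reorg 2026-08-19,
verbatim): «continuum YM on T⁴ ⇐ BetaPertH ∧ nine spine estimates (0/9 proved); BetaPertH ⇐ (D1) ∧ (D4) ∧ CAP+tail; G-an2-4 gates
asym, D1 and NE2/3/4.»  THIS MODULE DISCHARGES NOTHING: §1 is uniqueness bookkeeping for an ABSTRACT β with a GIVEN split of the printed type ((2.12)–(2.14) p. 268, tree
`B12Beta.OneLoopSplit`) under a DISPLAYED (AF-1) (NOT printed uniformly, GAPS G-b12-2) and node U2's HYPOTHESIS SHAPES (NOT printed, GAPS G-t4-U2-1∕2); §2 is bookkeeping BY NAME over the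
statement-exact typing `B12BetaAsPrinted` (`Theorem2Statement` — STATED WITHOUT PROOF in print, p. 259 — a HYPOTHESIS) with prover 1's binder `hrg`, part 11's `exists_bstar` ∕
`bstar_pos_of_typedTheorem2`, part 11f's `abs_const_sub_beta0_le` and part 13's `exists_zeroHist` ∕ `zeroHist_unique_at` ∕ `abs_zeroHist_succ_sub_le` ∕ `abs_zeroHist_sub_bstar_le` ∕
`tendsto_zeroHist_bstar` ∕ `abs_sub_zeroHist_le_sum_geom`.  `b⋆` and `b⁰` are a real ∕ a sequence with DISPLAYED properties; no definition.  Nothing is asserted about Bałaban's (1.22).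

WHAT THIS FILE PROVES (0 sorry, 0 def):
§1 **`beta0_eq_zeroHist`** (any printed-type split with (AF-1) has `β⁰ = b⁰`), `beta1_eq_histTerm`, **`beta1_fading_corner`** (`|β¹_{k+1}(v)| ≤ CΣθ^{k−i}v_i` on ]0, min(γ,γ′)]^{k+1}),
   `beta0_af0r` (the printed β⁰ obeys the intrinsic (AF-0r) `|β⁰_{k+2} − β⁰_{k+1}| ≤ cθ^k`).
§1″ `rgEqH_congr_of_agree`, **`exists_oneLoopSplit_of_moduli`** (the split LITERALLY: a box-equivalent family β′ with `T : OneLoopSplit β′`, `T.β0 = b⁰`, fading (AF-1) for `T.β1`).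
§1′ `tendsto_zeroHist_valueAtZero` (junction with bflow-p1's value at zero β₀ of `betaInf β`: `|b⁰_k − β₀| ≤ cθ^k∕(1−θ)`, `b⁰_k → β₀`).
§2 **`zeroHist_of_typedTheorem2`** (∃ b⁰, b⋆ > 0: `hb0`, `hb`, (AF-0r), `|b⁰_k − b⋆| ≤ cθ^k∕(1−θ)`, `b⁰_k → b⋆`, `∃ k₁ ∀ k ≥ k₁, b⋆∕2 ≤ b⁰_k`), `zeroHist_of_typedTheorem2'` (`hrg` discharged from
   `Definitions` + (U)).
NOT CLAIMED: a split, (AF-1), the letters or Theorem 2 for Bałaban's β; which reading print intends; `BetaPertH`; continuum; Clay.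
-/

namespace Summit.QuantumFields.BalabanUV.Beta.EriceFlowEnclosureB12AsPrintedPointwiseFadingZeroHistoryEnd

open Finset Filter Topology
open Literature.MathematicalPhysics.QuantumFieldTheory.Balaban1983to89
open Literature.MathematicalPhysics.QuantumFieldTheory.Balaban1983to89.B12BetaAsPrinted
open Literature.MathematicalPhysics.QuantumFieldTheory.Balaban1983to89.FlowStep (HBeta prefixOf Box mem_box box_mono RGEqH BetaUpperH)
open Literature.MathematicalPhysics.QuantumFieldTheory.Balaban1983to89.T4CouplingMatching (HistLipschitz FadingMemory ScaleShiftRate)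
open Literature.MathematicalPhysics.QuantumFieldTheory.Balaban1983to89.T4BetaStationary (SeqBox betaInf constant_nonneg_of_scaleShiftRate)
open Summit.QuantumFields.BalabanUV.Beta.EriceFlowEnclosureB12AsPrintedTunedUpper (hrg_of_betaUpperH)
open Summit.QuantumFields.BalabanUV.Beta.EriceFlowEnclosureB12AsPrintedPointwiseFadingLimit (exists_bstar)
open Summit.QuantumFields.BalabanUV.Beta.EriceFlowEnclosureB12AsPrintedPointwiseFadingLimitEnd (bstar_pos_of_typedTheorem2)
open Summit.QuantumFields.BalabanUV.Beta.EriceFlowEnclosureB12AsPrintedPointwiseFadingLimitOneLoop (abs_const_sub_beta0_le)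
open Summit.QuantumFields.BalabanUV.Beta.EriceFlowEnclosureB12AsPrintedPointwiseFadingLimitZeroJunction (hb_of_valueAtZero)
open Summit.QuantumFields.BalabanUV.Beta.EriceFlowEnclosureB12AsPrintedPointwiseFadingZeroHistory

noncomputable section

section Split

variable {β : HBeta} {γ γ' C Cr c θ : ℝ} {Λ : ℕ → ℕ → ℝ}

/-- **THE PRINTED SPLIT IS CANONICAL.**  If `T : OneLoopSplit β` (β = β⁰ + β¹, β¹ = 0 at the face g_k = 0) has the corner bound (AF-1) `|β¹_{k+1}(p)| ≤ C_r·p_k` on ]0, γ′]^{k+1}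
(`0 ≤ C_r`, `0 < γ′`), and `b⁰` are part 13's zero-history values on ]0, γ] (`hb0`, `0 ≤ C`, `θ < 1`, `0 < γ`), then **`T.β0 k = b⁰_k` for every k**: both are approached linearly by
`u ↦ β_{k+1}(u,…,u)` at `0⁺` (part 11f's `abs_const_sub_beta0_le`; part 13's `zeroHist_unique_at`).  The one-loop coefficient of [I] (2.12), granted (AF-1), is an INTRINSIC datum of the
family β.  LOCATED PRICE (b2b-an4 WORD-1, CLAIMS l.68389): (AF-1) is a hypothesis tying the split's NUMBERS to the OPEN-box values near the face; for the record's split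
(`Node00.oneLoopSplit_betaOfMerged`, numbers = limits along the zero EDGE `(0,…,0,g)`, outside every box for k ≥ 1) it is the CLOSED-box identification «diagonal corner value = zero-edge
one-loop number» with a linear rate — NOT a consequence of the open-box moduli (row D4's constant remainder (2.38)+(5.10) and the moduli's corner bound do not imply it).
[cite: Balaban1987RG1, (2.12)-(2.14) p.268 and §1 p.264] -/
theorem beta0_eq_zeroHist (T : B12Beta.OneLoopSplit β)
    (hAF1 : ∀ (k : ℕ) (p : Fin (k + 1) → ℝ), p ∈ Box γ' k → |T.β1 k p| ≤ Cr * p (Fin.last k)) (hCr : 0 ≤ Cr) (hγ' : 0 < γ')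
    (hθ1 : θ < 1) (hC : 0 ≤ C) (hγ : 0 < γ) {b0 : ℕ → ℝ}
    (hb0 : ∀ (k : ℕ) (u : ℝ), 0 < u → u ≤ γ → |β k (fun _ : Fin (k + 1) => u) - b0 k| ≤ C * u / (1 - θ)) (k : ℕ) :
    T.β0 k = b0 k := by
  have h1θ : 0 < 1 - θ := by linarith
  exact zeroHist_unique_at (β := β) hγ' hγ hCr (div_nonneg hC h1θ.le)
    (fun u hu huγ => abs_const_sub_beta0_le T hAF1 hu huγ k)
    (fun u hu huγ => (hb0 k u hu huγ).trans (le_of_eq (by ring)))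

/-- … hence the printed remainder IS part 13's history term: `T.β1 k v = β_{k+1}(v) − b⁰_k` for every history `v`. [cite: Balaban1987RG1, (2.12)-(2.14) p.268] -/
theorem beta1_eq_histTerm (T : B12Beta.OneLoopSplit β)
    (hAF1 : ∀ (k : ℕ) (p : Fin (k + 1) → ℝ), p ∈ Box γ' k → |T.β1 k p| ≤ Cr * p (Fin.last k)) (hCr : 0 ≤ Cr) (hγ' : 0 < γ')
    (hθ1 : θ < 1) (hC : 0 ≤ C) (hγ : 0 < γ) {b0 : ℕ → ℝ}
    (hb0 : ∀ (k : ℕ) (u : ℝ), 0 < u → u ≤ γ → |β k (fun _ : Fin (k + 1) => u) - b0 k| ≤ C * u / (1 - θ))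
    (k : ℕ) (v : Fin (k + 1) → ℝ) : T.β1 k v = β k v - b0 k := by
  rw [T.split k v, beta0_eq_zeroHist T hAF1 hCr hγ' hθ1 hC hγ hb0 k]
  ring

/-- **THE PRINTED REMAINDER INHERITS THE FADING CORNER BOUND FROM THE LETTERS**: under node U2's `HistLipschitz Λ γ β` + `FadingMemory C θ Λ` (0 ≤ θ < 1) and a split with (AF-1) as above,
`|β¹_{k+1}(v)| ≤ C·Σ_{i≤k} θ^{k−i}·v_i` for every `v ∈ ]0, γ]^{k+1}` (part 13's `abs_sub_zeroHist_le_sum_geom` through `beta1_eq_histTerm`) — a bound by ALL couplings with fading weights,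
in addition to the assumed last-coupling bound. [cite: Balaban1987RG1, (2.14) p.268 and §5 p.298] -/
theorem beta1_fading_corner (T : B12Beta.OneLoopSplit β)
    (hAF1 : ∀ (k : ℕ) (p : Fin (k + 1) → ℝ), p ∈ Box γ' k → |T.β1 k p| ≤ Cr * p (Fin.last k)) (hCr : 0 ≤ Cr) (hγ' : 0 < γ')
    (hL : HistLipschitz Λ γ β) (hΛ : FadingMemory C θ Λ) (hθ0 : 0 ≤ θ) (hθ1 : θ < 1) (hC : 0 ≤ C) (hγ : 0 < γ) {b0 : ℕ → ℝ}
    (hb0 : ∀ (k : ℕ) (u : ℝ), 0 < u → u ≤ γ → |β k (fun _ : Fin (k + 1) => u) - b0 k| ≤ C * u / (1 - θ))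
    {k : ℕ} {v : Fin (k + 1) → ℝ} (hv : v ∈ Box γ k) :
    |T.β1 k v| ≤ C * ∑ i : Fin (k + 1), θ ^ (k - (i : ℕ)) * v i := by
  rw [beta1_eq_histTerm T hAF1 hCr hγ' hθ1 hC hγ hb0 k v]
  exact abs_sub_zeroHist_le_sum_geom hL hΛ hθ0 hθ1 hC hγ hb0 hv

/-- **THE PRINTED β⁰ OBEYS THE INTRINSIC (AF-0r)**: with NE4 `ScaleShiftRate c θ γ β` in addition, `|T.β0 (k+1) − T.β0 k| ≤ cθ^k` for every k (part 13's `abs_zeroHist_succ_sub_le`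
through `beta0_eq_zeroHist`) — the β sub-cell's (AF-0r) letter for the printed one-loop coefficients, from the letters + (AF-1). [cite: Balaban1987RG1, (2.12) p.268; King1986, Thm 3.4 (3.9) p.656] -/
theorem beta0_af0r (T : B12Beta.OneLoopSplit β)
    (hAF1 : ∀ (k : ℕ) (p : Fin (k + 1) → ℝ), p ∈ Box γ' k → |T.β1 k p| ≤ Cr * p (Fin.last k)) (hCr : 0 ≤ Cr) (hγ' : 0 < γ')
    (hS : ScaleShiftRate c θ γ β) (hθ1 : θ < 1) (hC : 0 ≤ C) (hγ : 0 < γ) {b0 : ℕ → ℝ}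
    (hb0 : ∀ (k : ℕ) (u : ℝ), 0 < u → u ≤ γ → |β k (fun _ : Fin (k + 1) => u) - b0 k| ≤ C * u / (1 - θ)) (k : ℕ) :
    |T.β0 (k + 1) - T.β0 k| ≤ c * θ ^ k := by
  rw [beta0_eq_zeroHist T hAF1 hCr hγ' hθ1 hC hγ hb0 (k + 1), beta0_eq_zeroHist T hAF1 hCr hγ' hθ1 hC hγ hb0 k]
  exact abs_zeroHist_succ_sub_le hS hθ1 hC hγ hb0 k

end Split

/-! ## §1″ The split, literally: a box-equivalent family carrying a `OneLoopSplit` with `β⁰ = b⁰` and the fading (AF-1) -/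

section Literal

variable {β : HBeta} {γ C θ : ℝ} {Λ : ℕ → ℕ → ℝ}

/-- (0.20) only reads the β-functions ON THE BOXES: two families agreeing on ]0, γ]^{k+1} for every k have the same in-window solutions of level γ. [cite: Balaban1987RG1, (0.20) p.256] -/
theorem rgEqH_congr_of_agree {β' : HBeta} (hagree : ∀ (k : ℕ) (v : Fin (k + 1) → ℝ), v ∈ Box γ k → β' k v = β k v)
    {n : ℕ} {gs : ℕ → ℝ} (hI : Step.InInterval γ n gs) : RGEqH n β' gs ↔ RGEqH n β gs := by
  have hp : ∀ k, k < n → β' k (prefixOf gs k) = β k (prefixOf gs k) := fun k hk =>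
    hagree k _ (mem_box.mpr fun i => hI i ((Nat.le_of_lt_succ i.isLt).trans hk.le))
  constructor
  · intro h k hk; rw [← hp k hk]; exact h k hk
  · intro h k hk; rw [hp k hk]; exact h k hk

/-- **THE LETTERS MANUFACTURE THE PRINTED SPLIT, LITERALLY.**  Under node U2's `HistLipschitz Λ γ β` + `FadingMemory C θ Λ` (0 ≤ θ < 1, 0 ≤ C, 0 < γ) there are a family `β′` AGREEING WITH
`β` ON EVERY BOX ]0, γ]^{k+1} (so with the same in-window solutions of (0.20), `rgEqH_congr_of_agree`) and a printed-type split `T : B12Beta.OneLoopSplit β′` — `β′ = β⁰ + β¹` with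
`β¹_{k+1} = 0` AT the face `g_k = 0` — whose `β⁰` ARE the zero-history values of β (`|β_{k+1}(u,…,u) − T.β0 k| ≤ Cu∕(1−θ)`) and whose `β¹` obeys the FADING (AF-1)
`|β¹_{k+1}(v)| ≤ CΣθ^{k−i}v_i` on the boxes.  (`β′` re-sets β to `b⁰_k` on the face `g_k = 0`, outside every box; the tree's split-based roads — `B12Beta.betaLowerHist_of_split`, the
gaps cell's `Spine/NE4/LimitFormFromNE4` — thus apply to ANY family with the letters, up to box-agreement.)  Nothing is asserted about Bałaban's (1.22). [cite: Balaban1987RG1, (2.12)-(2.14) p.268 and §5 p.298] -/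
theorem exists_oneLoopSplit_of_moduli (hL : HistLipschitz Λ γ β) (hΛ : FadingMemory C θ Λ) (hθ0 : 0 ≤ θ) (hθ1 : θ < 1) (hC : 0 ≤ C)
    (hγ : 0 < γ) :
    ∃ (β' : HBeta) (T : B12Beta.OneLoopSplit β'),
      (∀ (k : ℕ) (v : Fin (k + 1) → ℝ), v ∈ Box γ k → β' k v = β k v) ∧
      (∀ (k : ℕ) (u : ℝ), 0 < u → u ≤ γ → |β k (fun _ : Fin (k + 1) => u) - T.β0 k| ≤ C * u / (1 - θ)) ∧
      ∀ (k : ℕ) (v : Fin (k + 1) → ℝ), v ∈ Box γ k → |T.β1 k v| ≤ C * ∑ i : Fin (k + 1), θ ^ (k - (i : ℕ)) * v i := by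
  classical
  obtain ⟨b0, hb0⟩ := exists_zeroHist hL hΛ hθ0 hθ1 hC hγ
  let β' : HBeta := fun k v => if v (Fin.last k) = 0 then b0 k else β k v
  have hagree : ∀ (k : ℕ) (v : Fin (k + 1) → ℝ), v ∈ Box γ k → β' k v = β k v := fun k v hv => by
    have hne : v (Fin.last k) ≠ 0 := ne_of_gt (mem_box.mp hv (Fin.last k)).1
    simp [β', hne]
  refine ⟨β', ⟨b0, fun k v => β' k v - b0 k, fun k v => by ring, fun k v hv => by simp [β', hv]⟩, hagree, fun k u hu huγ => ?_,
    fun k v hv => ?_⟩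
  · exact hb0 k u hu huγ
  · show |β' k v - b0 k| ≤ _
    rw [hagree k v hv]
    exact abs_sub_zeroHist_le_sum_geom hL hΛ hθ0 hθ1 hC hγ hb0 hv

end Literal

/-! ## §1′ Junction with prover 1: the zero-history values converge to the value at zero of the stationary functional -/

section Junction

variable {β : HBeta} {γ C c θ : ℝ}

/-- **`b⁰_k → β₀` (ONE NUMBER, THREE READINGS).**  If `β₀` carries bflow-p1's value-at-zero letter for node U2's stationary functional — `|betaInf β u − β₀| ≤ C·Σ'_j θ^j u_j` on all box
histories (part 32 `exists_valueAtZero`) — and `b⁰` are part 13's zero-history values (`hb0`), then under NE4 `|b⁰_k − β₀| ≤ cθ^k∕(1−θ)` for every k and `b⁰_k → β₀`: prover 1's β₀,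
part 11's `b⋆` (part 11i) and the limit of the intrinsic one-loop coefficients are the same real (part 11i's `hb_of_valueAtZero` + part 13 BY NAME). [cite: Balaban1987RG1, (2.12) p.268 and §5 p.298] -/
theorem tendsto_zeroHist_valueAtZero (hS : ScaleShiftRate c θ γ β) (hθ0 : 0 ≤ θ) (hθ1 : θ < 1) (hC : 0 ≤ C) (hγ : 0 < γ) {b0 : ℕ → ℝ}
    (hb0 : ∀ (k : ℕ) (u : ℝ), 0 < u → u ≤ γ → |β k (fun _ : Fin (k + 1) => u) - b0 k| ≤ C * u / (1 - θ)) {β₀ : ℝ}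
    (h0 : ∀ u : ℕ → ℝ, SeqBox γ u → |betaInf β u - β₀| ≤ C * ∑' j, θ ^ j * u j) :
    (∀ k, |b0 k - β₀| ≤ c * θ ^ k / (1 - θ)) ∧ Tendsto b0 atTop (𝓝 β₀) :=
  ⟨abs_zeroHist_sub_bstar_le hS hθ1 hC hγ hb0 (hb_of_valueAtZero hC hθ0 hθ1 h0),
    tendsto_zeroHist_bstar hS hθ0 hθ1 hC hγ hb0 (hb_of_valueAtZero hC hθ0 hθ1 h0)⟩

end Junction

/-! ## §2 On the as-printed carrier: Theorem 2 AS TYPED forces eventually positive intrinsic one-loop coefficients -/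

section Carrier

variable {S : Setting}

/-- **THE ZERO-HISTORY VALUES OF [I]'s SETTING, FROM THEOREM 2 AS TYPED.**  `Theorem2Statement S hL` AS TYPED (hypothesis) + prover 1's binder `hrg` + node U2's letters
`HistLipschitz Λ γ_U S.β` ∕ `FadingMemory C θ Λ` ∕ `ScaleShiftRate c θ γ_U S.β` (0 ≤ θ < 1, 0 ≤ C, 0 < γ_U) ⟹ there are zero-history values `b⁰` of `S.β` on ]0, γ_U] (`hb0`) and THE
asymptotic constant `b⋆` (`hb`) with **`0 < b⋆`**, the intrinsic (AF-0r) `|b⁰_{k+1} − b⁰_k| ≤ cθ^k`, the rate `|b⁰_k − b⋆| ≤ cθ^k∕(1−θ)`, `b⁰_k → b⋆`, and a threshold `k₁` with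
**`b⋆∕2 ≤ b⁰_k` for all `k ≥ k₁`** — EVENTUAL ONE-LOOP ASYMPTOTIC FREEDOM OF THE INTRINSIC COEFFICIENTS, no split assumed (part 11c's `bstar_pos_of_typedTheorem2` + part 13 BY NAME).
[cite: Balaban1987RG1, Thm 2 (0.31) p.259, (2.12)-(2.14) p.268, §5 p.298] -/
theorem zeroHist_of_typedTheorem2 {hL : Odd S.L ∧ 1 < S.L} (hT : Theorem2Statement S hL)
    {γU C c θ : ℝ} {Λ : ℕ → ℕ → ℝ} (hγU : 0 < γU) (hθ0 : 0 ≤ θ) (hθ1 : θ < 1) (hC : 0 ≤ C)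
    (hrg : ∀ P : B12.RunParams, Step.InInterval γU P.K (S.cpl P) → RGEqH P.K S.β (S.cpl P))
    (hLip : HistLipschitz Λ γU S.β) (hΛ : FadingMemory C θ Λ) (hS : ScaleShiftRate c θ γU S.β) :
    ∃ (b0 : ℕ → ℝ) (bstar : ℝ), 0 < bstar ∧
      (∀ (k : ℕ) (u : ℝ), 0 < u → u ≤ γU → |S.β k (fun _ : Fin (k + 1) => u) - b0 k| ≤ C * u / (1 - θ)) ∧
      (∀ u : ℝ, 0 < u → u ≤ γU → |betaInf S.β (fun _ : ℕ => u) - bstar| ≤ C * u / (1 - θ)) ∧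
      (∀ k, |b0 (k + 1) - b0 k| ≤ c * θ ^ k) ∧ (∀ k, |b0 k - bstar| ≤ c * θ ^ k / (1 - θ)) ∧
      Tendsto b0 atTop (𝓝 bstar) ∧ ∃ k₁ : ℕ, ∀ k, k₁ ≤ k → bstar / 2 ≤ b0 k := by
  have h1θ : 0 < 1 - θ := by linarith
  have hc : 0 ≤ c := constant_nonneg_of_scaleShiftRate hS hγU
  obtain ⟨b0, hb0⟩ := exists_zeroHist hLip hΛ hθ0 hθ1 hC hγU
  obtain ⟨bstar, hb⟩ := exists_bstar hLip hΛ hS hθ0 hθ1 hC hγU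
  have hpos : 0 < bstar := bstar_pos_of_typedTheorem2 hT hγU hθ0 hθ1 hC hrg hLip hΛ hS hb
  have hrate := abs_zeroHist_sub_bstar_le hS hθ1 hC hγU hb0 hb
  -- a threshold with cθ^{k₁}/(1−θ) ≤ b⋆/2
  obtain ⟨k₁, hk₁⟩ : ∃ k₁ : ℕ, c * θ ^ k₁ / (1 - θ) ≤ bstar / 2 := by
    rcases eq_or_lt_of_le hc with h0 | hcpos
    · exact ⟨0, by rw [← h0]; simp; positivity⟩
    · obtain ⟨k₁, hk⟩ := exists_pow_lt_of_lt_one (show 0 < bstar / 2 * (1 - θ) / c by positivity) hθ1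
      refine ⟨k₁, ?_⟩
      rw [div_le_iff₀ h1θ]
      have := (lt_div_iff₀ hcpos).mp hk
      linarith
  refine ⟨b0, bstar, hpos, hb0, hb, abs_zeroHist_succ_sub_le hS hθ1 hC hγU hb0, hrate,
    tendsto_zeroHist_bstar hS hθ0 hθ1 hC hγU hb0 hb, k₁, fun k hk => ?_⟩
  have h := (abs_le.mp (hrate k)).1
  have hθk : c * θ ^ k / (1 - θ) ≤ c * θ ^ k₁ / (1 - θ) :=
    div_le_div_of_nonneg_right (mul_le_mul_of_nonneg_left (pow_le_pow_of_le_one hθ0 hθ1.le hk) hc) h1θ.le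
  linarith

/-- The same with prover 1's binder `hrg` DISCHARGED from the printed `Definitions S` and the upper letter (U) `BetaUpperH M γ_U S.β` with `Mγ_U² < 1` (`hrg_of_betaUpperH` BY NAME).
[cite: Balaban1987RG1, Thm 2 (0.31) p.259 with §1 p.264] -/
theorem zeroHist_of_typedTheorem2' {hL : Odd S.L ∧ 1 < S.L} (hT : Theorem2Statement S hL) (hDef : Definitions S)
    {γU C c θ M : ℝ} {Λ : ℕ → ℕ → ℝ} (hγU : 0 < γU) (hθ0 : 0 ≤ θ) (hθ1 : θ < 1) (hC : 0 ≤ C)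
    (hub : BetaUpperH M γU S.β) (hMγ : M * γU ^ 2 < 1)
    (hLip : HistLipschitz Λ γU S.β) (hΛ : FadingMemory C θ Λ) (hS : ScaleShiftRate c θ γU S.β) :
    ∃ (b0 : ℕ → ℝ) (bstar : ℝ), 0 < bstar ∧
      (∀ (k : ℕ) (u : ℝ), 0 < u → u ≤ γU → |S.β k (fun _ : Fin (k + 1) => u) - b0 k| ≤ C * u / (1 - θ)) ∧
      (∀ u : ℝ, 0 < u → u ≤ γU → |betaInf S.β (fun _ : ℕ => u) - bstar| ≤ C * u / (1 - θ)) ∧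
      (∀ k, |b0 (k + 1) - b0 k| ≤ c * θ ^ k) ∧ (∀ k, |b0 k - bstar| ≤ c * θ ^ k / (1 - θ)) ∧
      Tendsto b0 atTop (𝓝 bstar) ∧ ∃ k₁ : ℕ, ∀ k, k₁ ≤ k → bstar / 2 ≤ b0 k :=
  zeroHist_of_typedTheorem2 hT hγU hθ0 hθ1 hC (hrg_of_betaUpperH hDef hγU hub hMγ) hLip hΛ hS

end Carrier

end

end Summit.QuantumFields.BalabanUV.Beta.EriceFlowEnclosureB12AsPrintedPointwiseFadingZeroHistoryEnd
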